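import Summits.BirchSwinnertonDyer.BirchSwinnertonDyer.Theorems.CMKolyvaginAtInertTwoKolyvaginPrimeInertAtTwo
import Literature.NumberTheory.EllipticCurves.SelmerTorsionRestriction
import HarnessLib

/-!
# Route `CMKolyvaginAtInertTwo`, crux `CMKolyvaginExactAtInertTwo` (stmt-BirchSwinnertonDyer-24277):
# THE OVER-`ℚ` BIT WITH THE `K`-SIDE INPUTS DISCHARGED — `y_K ∉ 2E(K)` ⟹ `Sel₂(E/K) ⊆ {0, δ₂ y_K}`
# modulo Poitou–Tate over `ℚ` (two binders), the descent binder, and the machine's data at `(2, 1)`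

Seat `bsd-line-cmk2-p1` g8 (cell `bsd-print-cf2`); helper (`--supports stmt-BirchSwinnertonDyer-24277`);
sequel to `…RationalDescentAtTwo.lean` (same seat: the over-`ℚ` bit as algebra with FOUR over-`ℚ`
binders). THEOREMS ONLY: no definition, no named fact, no `sorry`; no item is closed; BSD is not proved.

WHAT IS NEW HERE. Two of the four over-`ℚ` binders of the predecessor file are DISCHARGED by tree
theorems, by phrasing the local conditions at the Kolyvagin primes on the `K`-side (legitimate: at a
Kolyvagin prime `ℓ` — inert in `K`, `Frob_ℓ = τ` a transposition on `E[2]` — restriction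
`H¹(ℚ_ℓ, E[2]) → H¹(K_λ, E[2])` is injective, `H¹(K_λ/ℚ_ℓ, E[2]) = ⟨T⟩/⟨T⟩ = 0`; only at the ramified
prime `q = −d_K` must the strict condition stay on the `ℚ`-side, the ramified line of `H¹(ℚ_q, E[2])`
dying in `H¹(K_w, E[2])`):
* (ram) "`(δ₂ y_K)_λ ≠ 0 ⟹ c(ℓ)` not Selmer at `λ`" is Gross's Prop. 6.2 (2), i.e. the local criterion
  of the machine's point system (`hpoints`, as in g6's `conjAct_eq_self_of_mem_selmerGroup_two`);
* (ceb) "two non-zero `τ`-invariant classes are simultaneously non-zero at `λ` for some Kolyvagin `ℓ`"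
  is g3's Čebotarev leaf at `2` (`KolyvaginImageTwo.exists_kolyvaginPrime_gt_two`, p597930; conditional on
  the tree's named fact `chebotarev_artinRep` through its `_holds` companion, exactly as g6), applied to
  `(res ξ, δ₂ y_K)` — restricted classes are `τ`-invariant (`conjAct_resTorsion`).
What remains as binders (all standard, none in the tree's elliptic-curve currency over `ℚ`):
* (inj) `res : H¹(ℚ, E[2]) → H¹(K, E[2])` injective (`E(K)[2] = 0`: inflation–restriction);
* (desc) every `τ`-invariant class of `Sel₂(E/K)` is `res ξ` with `ξ` Selmer over `ℚ` at every place of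
  `ℚ` other than `u = (q)` (inflation–restriction + `H¹(K_w/ℚ_v, E(K_w)) = 0` at unramified `v` of good
  reduction, Milne ADT I.3.8, + `H¹(ℝ, E[2]) = 0` for `Δ_E < 0` + split places);
* (dual) Poitou–Tate OVER `ℚ` with local duality at `ℓ`: for a `τ`-invariant `d ∈ H¹(K, E[2])` Selmer off
  `λ` and NOT Selmer at `λ` (it descends to `κ ∈ H¹(ℚ, E[2])` Selmer off `{ℓ, q}`), every relaxed-Selmer
  `ξ ∈ H¹(ℚ, E[2])` STRICT at `q` has `(res ξ)_λ = 0` (`∑_v inv_v(ξ_v ∪ κ_v) = inv_ℓ(ξ_ℓ ∪ κ_ℓ) = 0` and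
  `H¹_ur(ℚ_ℓ, E[2]) ≅ ℤ/2` is self-annihilating — THE SECOND BIT);
* (lag) the one-place Poitou–Tate count at `q` with `#E(ℚ_q)[2] = 2` (`Frob_q` a transposition on `E[2]`,
  forced up to the case `Frob_q = 1` by Kramer–Monsky parity): two relaxed classes not strict at `q`
  differ by a strict one (`#S^♯ = 2 · #S_♭`).

* §1 `selmer_two_eq_zero_or_eq_kummer_of_hpoints` — general form (`ρ̄_{E,2}` onto, `Δ_E < 0`,
  `Δ_E ∉ K²`, `K` imaginary quadratic, `P = y_K` Heegner of level `N`, `P ∉ 2E(K)`, `hpoints` at `(2,1)`,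
  `τ = 1` on `Sel₂(E/K)` as a hypothesis, the four binders above) ⟹ `Sel₂(E/K) ⊆ {0, δ₂ P}`.
* §2 `selmer_two_eq_zero_or_eq_kummer_of_cmInert_families` — ON THE HABITAT H₂ (`HasCM`, `CMInert W 2`,
  `ρ̄₂` onto, Heegner `K`): `Δ < 0`, `Δ ∉ K²` automatic (p591040, p596346), `hpoints` and `τ = 1` from
  ty2's CM-inert-supported data (p601266) via g6 (p609668): **`Sel₂(E/K) ⊆ {0, δ₂ y_K}` — the `M₀ = 0`
  case of the crux (`Ш(E/K)[2] = 0`, `#Ш(E/K)[2^∞] = 4⁰`) modulo (inj), (desc), (dual), (lag)**, for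
  `d_K = −q` prime with `Frob_q` a transposition on `E[2]`.

References: [GrossLMS1991] §5 (5.1), Props. 5.4, 6.2, §§9–10; [McCallumLMS1991] §2 Prop. 2.2, §3 (3),
Cor. 3.2, §5 Lemma 5.3; [MilneADT2006] I Cor. 2.3, Thm. 2.6, Prop. 3.8, Thm. 4.10; [Kramer1981] Prop. 3;
[Kolyvagin1989Izv] §3.
-/

-- single-conjunct summit: `Summit.BirchSwinnertonDyer.BirchSwinnertonDyer.…` repeats the name by design
set_option linter.dupNamespace false
set_option autoImplicit false

noncomputable section

open scoped Classical
open WeierstrassCurve NumberField IsDedekindDomain Field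
open Literature.NumberTheory.GaloisRepresentations Literature.NumberTheory.EllipticCurves

namespace Summit.BirchSwinnertonDyer.BirchSwinnertonDyer.Theorems.KolyvaginRatDescentTwo

-- `K : Type` (universe 0) as in the Čebotarev leaf at `2` (p597930) and the route items
variable (W : WeierstrassCurve ℚ) {K : Type} [Field K] [NumberField K]

/-! ## §1 `Sel₂(E/K) ⊆ {0, δ₂ y_K}` from the point system at `(2, 1)`, `τ = 1`, and the over-`ℚ` binders -/

/-- **`y_K ∉ 2E(K)` ⟹ `Sel₂(E/K) ⊆ {0, δ₂ y_K}`, the `K`-side inputs discharged.** Setting: `E/ℚ` with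
`ρ̄_{E,2}` onto, `Δ_E < 0`, `K` imaginary quadratic with `Δ_E ∉ K²` and conjugation `c ≠ 1`, `P ∈ E(K)`
(the Heegner point `y_K` of level `N`) with `2Q ≠ P` for all `Q ∈ E(K)`; `hpoints` = the point-system binder of the
kernel Kolyvagin machine at `(p, M) = (2, 1)` (Gross (4.4), Props. 5.3, 5.4, 6.2 — at `2` a hypothesis, ty2's
data); `hτ` : `c_* = 1` on `Sel₂(E/K)` (g6's `τ`-part descent); `u` the exceptional place of `ℚ` (`q = −d_K`);
a class `ξ ∈ H¹(ℚ, E[2])` is RELAXED if it satisfies the Selmer condition at every finite place `≠ u` and at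
`∞`. Binders: (inj) `res` injective; (desc) `τ`-invariant Selmer classes over `K` are restrictions of relaxed
classes; (dual) Poitou–Tate over `ℚ` + local duality at a Kolyvagin `ℓ`, for relaxed classes strict at `u`
against a `τ`-invariant class Selmer off `λ` and not Selmer at `λ`; (lag) the one-place count at `u`.
Conclusion: every `s ∈ Sel₂(E/K)` is `0` or `δ₂ P`. Proof: the relaxed classes strict at `u` vanish — for
such `ξ ≠ 0`, the Čebotarev leaf at `2` (p597930) applied to the `τ`-invariant pair `(res ξ, δ₂ P)` gives a
Kolyvagin prime `ℓ` with `(res ξ)_λ ≠ 0 ≠ (δ₂ P)_λ`; Gross 6.2 (2) makes `c(ℓ)` non-Selmer at `λ`; `c(ℓ)`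
is `τ`-invariant mod `2` and Selmer off `λ`; (dual) forces `(res ξ)_λ = 0`, contradiction — then (lag)
and (desc). [cite: GrossLMS1991, §10 and Props. 5.4 (2), 6.2] [cite: McCallumLMS1991, §2 Prop. 2.2, §3
Cor. 3.2] [cite: MilneADT2006, Ch. I, Thm. 4.10] -/
theorem selmer_two_eq_zero_or_eq_kummer_of_hpoints {N : ℕ} [NeZero N] [W.IsElliptic]
    (hK : IsImaginaryQuadratic K) (P : (W.baseChange K).toAffine.Point)
    (hρ : W.HasSurjectiveModNGaloisRep 2) (hΔ : W.Δ < 0) (hΔK : ¬ IsSquare (W.baseChange K).Δ)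
    {c : K ≃ₐ[ℚ] K} (hc : c ≠ 1) (hy : ∀ Q : (W.baseChange K).toAffine.Point, 2 • Q ≠ P)
    {q : ℕ} (hq : q = 2)
    (hdiv : ∀ Q : geomPoints (W.baseChange K), ∃ R, (q : ℤ) • R = Q)
    (hpoints : ∃ (ε : ℤ) (τ : AlgebraicClosure K ≃+* AlgebraicClosure K) (hτ : IsLiftOfAut c τ)
        (A : ℕ → AddSubgroup (geomPoints (W.baseChange K)))
        (hA : ∀ m, KolyvaginCocycle.IsAdmissible (Field.absoluteGaloisGroup K) (A m) (q : ℤ))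
        (Pt : ℕ → geomPoints (W.baseChange K))
        (hPt : ∀ m, Pt m ∈ KolyvaginCocycle.invPoints (Field.absoluteGaloisGroup K) (A m) (q : ℤ)),
        (ε = 1 ∨ ε = -1) ∧
        IsOfFinAddOrder (Affine.Point.map (W' := W) (c : K →ₐ[ℚ] K) P - ε • P) ∧
        (∀ m, ∀ a ∈ A m, hτ.pointsMap W a ∈ A m) ∧
        Pt 1 = toGeomPoints (W.baseChange K) P ∧
        (∀ m : ℕ, Squarefree m →
          (∀ q' ∈ m.primeFactors, IsKolyvaginPrime N W K 2 q' ∧ FrobEqFrobInfty W K q q') →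
          (∃ B ∈ A m, hτ.pointsMap W (Pt m) =
            (ε * (-1) ^ m.primeFactors.card) • Pt m + (q : ℤ) • B) ∧
          (∀ v : HeightOneSpectrum (𝓞 K), (m : 𝓞 K) ∉ v.asIdeal →
            kolyvaginClass (W.baseChange K) _ hdiv (hA m) (Pt m) (hPt m) ∈
              selmerLocalKer (W.baseChange K) (v.adicCompletion K) (q : ℤ)) ∧
          (∀ ℓ : ℕ, ℓ.Prime → ℓ ∣ m → ∀ v : HeightOneSpectrum (𝓞 K), (ℓ : 𝓞 K) ∈ v.asIdeal →
            ∀ a : ℕ, ((((2 : ℕ) : ℤ) ^ a) •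
                kolyvaginClass (W.baseChange K) _ hdiv (hA m) (Pt m) (hPt m) ∈
                selmerLocalKer (W.baseChange K) (v.adicCompletion K) (q : ℤ) ↔
              (((2 : ℕ) : ℤ) ^ a) • kolyvaginClass (W.baseChange K) _ hdiv (hA (m / ℓ)) (Pt (m / ℓ))
                  (hPt (m / ℓ)) ∈
                (W.baseChange K).torsionLocalKer (v.adicCompletion K) (q : ℤ)))))
    (hτ : ∀ s ∈ selmerGroup (W.baseChange K) (q : ℤ), conjAct W c (q : ℤ) s = s)
    (hinj : Function.Injective (resTorsion W K (q : ℤ)))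
    (u : HeightOneSpectrum (𝓞 ℚ))
    (hdesc : ∀ s ∈ selmerGroup (W.baseChange K) (q : ℤ), conjAct W c (q : ℤ) s = s →
      ∃ ξ : galH1Torsion W (q : ℤ),
        ((∀ v : HeightOneSpectrum (𝓞 ℚ), v ≠ u → ξ ∈ selmerLocalKer W (v.adicCompletion ℚ) (q : ℤ)) ∧
          ∀ w : InfinitePlace ℚ, ξ ∈ selmerLocalKer W w.Completion (q : ℤ)) ∧
        resTorsion W K (q : ℤ) ξ = s)
    (hdual : ∀ {ℓ : ℕ} (hℓ : IsKolyvaginPrime N W K 2 ℓ), FrobEqFrobInfty W K q ℓ →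
      ∀ d : galH1Torsion (W.baseChange K) (q : ℤ), conjAct W c (q : ℤ) d = d →
      (∀ v : HeightOneSpectrum (𝓞 K), (ℓ : 𝓞 K) ∉ v.asIdeal →
        d ∈ selmerLocalKer (W.baseChange K) (v.adicCompletion K) (q : ℤ)) →
      (∀ w : InfinitePlace K, d ∈ selmerLocalKer (W.baseChange K) w.Completion (q : ℤ)) →
      d ∉ selmerLocalKer (W.baseChange K) (hℓ.place.adicCompletion K) (q : ℤ) →
      ∀ ξ : galH1Torsion W (q : ℤ),
      ((∀ v : HeightOneSpectrum (𝓞 ℚ), v ≠ u → ξ ∈ selmerLocalKer W (v.adicCompletion ℚ) (q : ℤ)) ∧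
          ∀ w : InfinitePlace ℚ, ξ ∈ selmerLocalKer W w.Completion (q : ℤ)) →
      ξ ∈ W.torsionLocalKer (u.adicCompletion ℚ) (q : ℤ) →
      resTorsion W K (q : ℤ) ξ ∈ (W.baseChange K).torsionLocalKer (hℓ.place.adicCompletion K) (q : ℤ))
    (hlag : ∀ ξ₁ ξ₂ : galH1Torsion W (q : ℤ),
      ((∀ v : HeightOneSpectrum (𝓞 ℚ), v ≠ u → ξ₁ ∈ selmerLocalKer W (v.adicCompletion ℚ) (q : ℤ)) ∧
          ∀ w : InfinitePlace ℚ, ξ₁ ∈ selmerLocalKer W w.Completion (q : ℤ)) →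
      ((∀ v : HeightOneSpectrum (𝓞 ℚ), v ≠ u → ξ₂ ∈ selmerLocalKer W (v.adicCompletion ℚ) (q : ℤ)) ∧
          ∀ w : InfinitePlace ℚ, ξ₂ ∈ selmerLocalKer W w.Completion (q : ℤ)) →
      ξ₁ ∉ W.torsionLocalKer (u.adicCompletion ℚ) (q : ℤ) →
      ξ₂ ∉ W.torsionLocalKer (u.adicCompletion ℚ) (q : ℤ) →
      ξ₁ - ξ₂ ∈ W.torsionLocalKer (u.adicCompletion ℚ) (q : ℤ)) :
    ∀ s ∈ selmerGroup (W.baseChange K) (q : ℤ),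
      s = 0 ∨ s = kummerMapTorsion (W.baseChange K) (q : ℤ) hdiv P := by
  subst hq
  classical
  haveI : Fact (Nat.Prime 2) := ⟨Nat.prime_two⟩
  haveI : Algebra.IsQuadraticExtension ℚ K := ⟨hK.1⟩
  haveI : IsTotallyComplex K := hK.2
  -- ### the classes `c(m)` from the points, `c(1) = δ₂ y_K`
  obtain ⟨ε, τ, hτl, A, hA, Pt, hPt, hε, -, hAτ, hPt1, hrel⟩ := hpoints
  obtain ⟨cl, hcl⟩ : ∃ cl : ℕ → galH1Torsion (W.baseChange K) (((2 : ℕ) : ℕ) : ℤ),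
      ∀ m, cl m = kolyvaginClass (W.baseChange K) _ hdiv (hA m) (Pt m) (hPt m) := ⟨_, fun _ ↦ rfl⟩
  have hP1 : toGeomPoints (W.baseChange K) P ∈
      KolyvaginCocycle.invPoints (Field.absoluteGaloisGroup K) (A 1) (((2 : ℕ) : ℕ) : ℤ) := by
    rw [← hPt1]; exact hPt 1
  have hc1 : cl 1 = kummerMapTorsion (W.baseChange K) _ hdiv P := by
    rw [hcl 1, KolyvaginDescent.kolyvaginClass_congr_point (hA 1) (hP' := hP1) hPt1]
    exact kolyvaginClass_toGeomPoints (hA 1) P hP1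
  -- ### `2 · H¹(K, E₂) = 0`
  have h2 : ∀ z : galH1Torsion (W.baseChange K) (((2 : ℕ) : ℕ) : ℤ), z + z = 0 := fun z ↦ by
    have h : (2 : ℤ) • z = 0 := zsmul_galH1Torsion_eq_zero (W.baseChange K) _ z
    rwa [two_zsmul] at h
  have hneg : ∀ z : galH1Torsion (W.baseChange K) (((2 : ℕ) : ℕ) : ℤ), -z = z := fun z ↦
    neg_eq_of_add_eq_zero_left (h2 z)
  -- ### `x_K = c(1) = δ₂ y_K ≠ 0` (as `y_K ∉ 2E(K)`), Selmer, `τ`-invariant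
  have hx0 : cl 1 ≠ 0 := by
    intro h0
    have hker : P ∈ (kummerMapTorsion (W.baseChange K) _ hdiv).ker := by
      rw [AddMonoidHom.mem_ker, ← hc1, h0]
    rw [kummerMapTorsion_ker, AddMonoidHom.mem_range] at hker
    obtain ⟨R, hR⟩ := hker
    refine hy R ?_
    have hR' : (((2 : ℕ) : ℕ) : ℤ) • R = P := hR
    rwa [natCast_zsmul] at hR'
  have hxS : cl 1 ∈ selmerGroup (W.baseChange K) (((2 : ℕ) : ℕ) : ℤ) := by
    rw [hc1]
    exact (mem_selmerGroup_iff (W.baseChange K) _ _).mpr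
      ⟨fun v ↦ kummerMapTorsion_mem_selmerLocalKer (W.baseChange K) _ hdiv (v.adicCompletion K) P,
        fun w ↦ kummerMapTorsion_mem_selmerLocalKer (W.baseChange K) _ hdiv w.Completion P⟩
  have hx1 : conjAct W c _ (cl 1) = cl 1 := hτ _ hxS
  -- ### the descent `x` of `δ₂ y_K`
  obtain ⟨x, hxrel, hxres⟩ := hdesc _ hxS hx1
  have hxne : x ≠ 0 := by
    rintro rfl
    exact hx0 (by rw [← hxres, map_zero])
  -- ### restricted classes are `τ`-invariant
  have hτres : ∀ ξ : galH1Torsion W (((2 : ℕ) : ℕ) : ℤ),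
      conjAct W c _ (resTorsion W K _ ξ) = resTorsion W K _ ξ := fun ξ ↦
    conjAct_resTorsion K W _ c hK.1 hc ξ
  -- ### STEP 1: relaxed classes strict at `u` vanish (Čebotarev + Gross 6.2 (2) + (dual))
  have hstrict : ∀ ξ : galH1Torsion W (((2 : ℕ) : ℕ) : ℤ),
      ((∀ v : HeightOneSpectrum (𝓞 ℚ), v ≠ u → ξ ∈ selmerLocalKer W (v.adicCompletion ℚ) _) ∧
          ∀ w : InfinitePlace ℚ, ξ ∈ selmerLocalKer W w.Completion _) →
      ξ ∈ W.torsionLocalKer (u.adicCompletion ℚ) _ → ξ = 0 := by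
    intro ξ hξrel hξu
    by_contra hξ0
    have hrξ0 : resTorsion W K _ ξ ≠ 0 := by
      intro h
      exact hξ0 (hinj (by rw [h, map_zero]))
    -- Čebotarev at `2`: a Kolyvagin prime `ℓ` with `(res ξ)_λ ≠ 0` and `x_λ ≠ 0`
    have hC := Literature.NumberTheory.Automorphic.chebotarev_artinRep_holds
    obtain ⟨ℓ, hℓK, hux⟩ : ∃ ℓ : ℕ, IsKolyvaginPrime N W K 2 ℓ ∧
        ∀ v : HeightOneSpectrum (𝓞 K), (ℓ : 𝓞 K) ∈ v.asIdeal →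
          resTorsion W K _ ξ ∉
              (W.baseChange K).torsionLocalKer (v.adicCompletion K) (((2 : ℕ) : ℕ) : ℤ) ∧
            cl 1 ∉ (W.baseChange K).torsionLocalKer (v.adicCompletion K) (((2 : ℕ) : ℕ) : ℤ) := by
      by_cases hux : resTorsion W K _ ξ = cl 1
      · obtain ⟨ℓ, -, hℓ, hℓN, hℓD, hℓ2, hprime, hfrob, hloc⟩ :=
          KolyvaginImageTwo.exists_kolyvaginPrime_gt_two hC (N := N) W hK hρ hΔ hΔK hc ![cl 1]
            (fun i ↦ by fin_cases i; exact hx1) (fun _ ↦ 1) (fun _ ↦ le_rfl)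
            (KolyvaginDescentTwo.dvd_two_of_sum_one h2 hx0) 0
        refine ⟨ℓ, ⟨hℓ, hℓN, hℓD, hℓ2, hprime, hfrob⟩, fun v hv ↦ ?_⟩
        have h1 := hloc 0 v hv
        simp only [Matrix.cons_val_zero, one_ne_zero, iff_false] at h1
        exact ⟨hux ▸ h1, h1⟩
      · obtain ⟨ℓ, -, hℓ, hℓN, hℓD, hℓ2, hprime, hfrob, hloc⟩ :=
          KolyvaginImageTwo.exists_kolyvaginPrime_gt_two hC (N := N) W hK hρ hΔ hΔK hc
            ![resTorsion W K _ ξ, cl 1]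
            (fun i ↦ by fin_cases i; exacts [hτres ξ, hx1]) (fun _ ↦ 1) (fun _ ↦ le_rfl)
            (KolyvaginDescentTwo.dvd_two_of_sum_two h2 hrξ0 hx0 hux) 0
        refine ⟨ℓ, ⟨hℓ, hℓN, hℓD, hℓ2, hprime, hfrob⟩, fun v hv ↦ ?_⟩
        have h0 := hloc 0 v hv
        have h1 := hloc 1 v hv
        simp only [Matrix.cons_val_zero, Matrix.cons_val_one, one_ne_zero, iff_false] at h0 h1
        exact ⟨h0, h1⟩
    have hfrob1 : FrobEqFrobInfty W K 2 ℓ := hℓK.2.2.2.2.2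
    have hℓprime : ℓ.Prime := hℓK.prime
    -- Kolyvagin's class `d = c(ℓ)`: `τ`-invariant, Selmer off `ℓ` and at `∞`, NOT Selmer at `λ`
    have hkol : ∀ q' ∈ ℓ.primeFactors, IsKolyvaginPrime N W K 2 q' ∧ FrobEqFrobInfty W K 2 q' := by
      intro q' hq'
      rw [hℓprime.primeFactors, Finset.mem_singleton] at hq'
      subst hq'
      exact ⟨hℓK, hfrob1⟩
    obtain ⟨h541, hdsel, hdloc⟩ := hrel ℓ hℓprime.squarefree hkol
    have hdeig : conjAct W c _ (cl ℓ) = cl ℓ := by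
      have h := conjAct_kolyvaginClass_eq_smul W (hdiv := hdiv) hτl (hA ℓ) (hAτ ℓ) (hPt ℓ) _ h541
      rw [← hcl ℓ, hℓprime.primeFactors, Finset.card_singleton, pow_one, mul_neg_one] at h
      rcases hε with rfl | rfl
      · rwa [neg_one_zsmul, hneg] at h
      · rwa [neg_neg, one_smul] at h
    have hdsel' : ∀ v : HeightOneSpectrum (𝓞 K), (ℓ : 𝓞 K) ∉ v.asIdeal →
        cl ℓ ∈ selmerLocalKer (W.baseChange K) (v.adicCompletion K) (((2 : ℕ) : ℕ) : ℤ) :=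
      fun v hv ↦ by rw [hcl ℓ]; exact hdsel v hv
    have hdloc' : cl ℓ ∈ selmerLocalKer (W.baseChange K) (hℓK.place.adicCompletion K)
          (((2 : ℕ) : ℕ) : ℤ) ↔
        cl (ℓ / ℓ) ∈ (W.baseChange K).torsionLocalKer (hℓK.place.adicCompletion K)
          (((2 : ℕ) : ℕ) : ℤ) := by
      have h := hdloc ℓ hℓprime dvd_rfl hℓK.place hℓK.mem_place 0
      rw [pow_zero, one_smul, one_smul, ← hcl ℓ, ← hcl (ℓ / ℓ)] at h
      exact h
    rw [Nat.div_self hℓprime.pos] at hdloc'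
    have hdv : cl ℓ ∉ selmerLocalKer (W.baseChange K) (hℓK.place.adicCompletion K)
        (((2 : ℕ) : ℕ) : ℤ) :=
      fun hmem ↦ (hux hℓK.place hℓK.mem_place).2 (hdloc'.mp hmem)
    have hdinf : ∀ w : InfinitePlace K,
        cl ℓ ∈ selmerLocalKer (W.baseChange K) w.Completion (((2 : ℕ) : ℕ) : ℤ) := fun w ↦ by
      haveI : IsAlgClosed w.Completion := isAlgClosed_of_ringEquiv
        (InfinitePlace.Completion.ringEquivComplexOfIsComplex (IsTotallyComplex.isComplex w)).symm
      rw [WeierstrassCurve.selmerLocalKer_eq_top_of_isAlgClosed]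
      trivial
    -- (dual): `(res ξ)_λ = 0` — contradiction with the choice of `ℓ`
    exact (hux hℓK.place hℓK.mem_place).1
      (hdual hℓK hfrob1 (cl ℓ) hdeig hdsel' hdinf hdv ξ hξrel hξu)
  -- ### STEP 2: `x` is not strict at `u`; a relaxed class is `0` or `x` (by (lag))
  have hxu : x ∉ W.torsionLocalKer (u.adicCompletion ℚ) _ := fun h ↦ hxne (hstrict x hxrel h)
  have hrelsub : ∀ ξ₁ ξ₂ : galH1Torsion W (((2 : ℕ) : ℕ) : ℤ),
      ((∀ v : HeightOneSpectrum (𝓞 ℚ), v ≠ u → ξ₁ ∈ selmerLocalKer W (v.adicCompletion ℚ) _) ∧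
          ∀ w : InfinitePlace ℚ, ξ₁ ∈ selmerLocalKer W w.Completion _) →
      ((∀ v : HeightOneSpectrum (𝓞 ℚ), v ≠ u → ξ₂ ∈ selmerLocalKer W (v.adicCompletion ℚ) _) ∧
          ∀ w : InfinitePlace ℚ, ξ₂ ∈ selmerLocalKer W w.Completion _) →
      ((∀ v : HeightOneSpectrum (𝓞 ℚ), v ≠ u → ξ₁ - ξ₂ ∈ selmerLocalKer W (v.adicCompletion ℚ) _) ∧
          ∀ w : InfinitePlace ℚ, ξ₁ - ξ₂ ∈ selmerLocalKer W w.Completion _) :=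
    fun ξ₁ ξ₂ h₁ h₂ ↦ ⟨fun v hv ↦ AddSubgroup.sub_mem _ (h₁.1 v hv) (h₂.1 v hv),
      fun w ↦ AddSubgroup.sub_mem _ (h₁.2 w) (h₂.2 w)⟩
  -- ### conclusion
  intro s hs
  obtain ⟨ξ, hξrel, hξres⟩ := hdesc s hs (hτ s hs)
  by_cases hξu : ξ ∈ W.torsionLocalKer (u.adicCompletion ℚ) _
  · left
    rw [← hξres, hstrict ξ hξrel hξu, map_zero]
  · right
    have h0 : ξ - x = 0 := hstrict (ξ - x) (hrelsub ξ x hξrel hxrel) (hlag ξ x hξrel hxrel hξu hxu)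
    rw [← hξres, sub_eq_zero.mp h0, hxres, hc1]

/-! ## §2 On the habitat H₂: `hpoints`, `τ = 1`, `Δ < 0`, `Δ ∉ K²` discharged by ty2's data and g6 -/

/-- **ON THE HABITAT H₂ — `y_K ∉ 2E(K)` ⟹ `Sel₂(E/K) ⊆ {0, δ₂ y_K}` modulo (inj), (desc), (dual),
(lag).** `E/ℚ` with `HasCM`, `2` inert in `F = Frac End E`, `ρ̄_{E,2}` onto; `K` imaginary quadratic with
the Heegner hypothesis for `N_E` and conjugation `c ≠ 1`; `P = y_K ∈ E(K)` a Heegner point of level `N_E`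
with `P ∉ 2E(K)` (`M₀ = 0`); `D`, `R` = ty2's CM-inert-supported Kolyvagin-system DATA at `p = 2`
(`PointSystemFamily` / `ReciprocityFamily`, p601266: Gross (4.4), Props. 5.3, 5.4, 6.2 and the
pairing-form reciprocity over `K` — at `2`/CM these are hypotheses). From them: `Δ_E < 0`, `Δ_E ∉ K²`
(p591040, p596346), the point system at `(2, 1)` (every Gross-form Kolyvagin prime of `(2, 1)` is
CM-inert, g6 p609668) and `τ = 1` on `Sel₂(E/K)` (g6's `conjAct_eq_self_of_cmInert_families_two`). The
four remaining binders are the over-`ℚ` inputs (inj), (desc), (dual), (lag) of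
`selmer_two_eq_zero_or_eq_kummer_of_hpoints` (inflation–restriction, Poitou–Tate over `ℚ` with local
duality at `ℓ`, the one-place count at `u = (q)`, `d_K = −q`, `#E(ℚ_q)[2] = 2`). CONCLUSION: every class of
`Sel₂(E/K)` is `0` or `δ₂ y_K` — so `E(K)/2E(K) = ⟨y_K⟩`, `Ш(E/K)[2] = 0`, `#Ш(E/K)[2^∞] = 1 = 4^{M₀}`:
the `M₀ = 0` case of the crux `CMKolyvaginExactAtInertTwo`, modulo the displayed inputs.
[cite: GrossLMS1991, Prop. 2.1 with §10, Props. 5.4, 6.2] [cite: McCallumLMS1991, §2 Prop. 2.2, §3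
Cor. 3.2, §5 Lemma 5.3] [cite: Kolyvagin1989Izv, §3] [cite: MilneADT2006, Ch. I, Thm. 4.10] -/
theorem selmer_two_eq_zero_or_eq_kummer_of_cmInert_families [W.IsElliptic] [W.IsGloballyMinimal]
    [NeZero (W.conductorNorm ℤ)] (hCM : W.HasCM)
    (hin : Literature.NumberTheory.EllipticCurves.Rank1Residual.CMInert W 2)
    (hsurj : W.HasSurjectiveModNGaloisRep 2) (hK : IsImaginaryQuadratic K)
    (hH : SatisfiesHeegnerHypothesis (W.conductorNorm ℤ) K)
    {P : (W.baseChange K).toAffine.Point} (hP : IsHeegnerPoint (W.conductorNorm ℤ) W K P)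
    {c : K ≃ₐ[ℚ] K} (hc : c ≠ 1) (hy : ∀ Q : (W.baseChange K).toAffine.Point, 2 • Q ≠ P)
    (D : Rank1Residual.P2.KolyvaginMachine.PointSystemFamily (W.conductorNorm ℤ) W K P 2
      (Literature.NumberTheory.EllipticCurves.Rank1Residual.CMInert W))
    (R : Rank1Residual.P2.KolyvaginMachine.ReciprocityFamily (W.conductorNorm ℤ) W K 2
      (Literature.NumberTheory.EllipticCurves.Rank1Residual.CMInert W))
    (hdiv : ∀ Q : geomPoints (W.baseChange K), ∃ R, ((2 ^ 1 : ℕ) : ℤ) • R = Q)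
    (hinj : Function.Injective (resTorsion W K ((2 ^ 1 : ℕ) : ℤ)))
    (u : HeightOneSpectrum (𝓞 ℚ))
    (hdesc : ∀ s ∈ selmerGroup (W.baseChange K) ((2 ^ 1 : ℕ) : ℤ),
      conjAct W c ((2 ^ 1 : ℕ) : ℤ) s = s → ∃ ξ : galH1Torsion W ((2 ^ 1 : ℕ) : ℤ),
        ((∀ v : HeightOneSpectrum (𝓞 ℚ), v ≠ u →
            ξ ∈ selmerLocalKer W (v.adicCompletion ℚ) ((2 ^ 1 : ℕ) : ℤ)) ∧
          ∀ w : InfinitePlace ℚ, ξ ∈ selmerLocalKer W w.Completion ((2 ^ 1 : ℕ) : ℤ)) ∧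
        resTorsion W K ((2 ^ 1 : ℕ) : ℤ) ξ = s)
    (hdual : ∀ {ℓ : ℕ} (hℓ : IsKolyvaginPrime (W.conductorNorm ℤ) W K 2 ℓ),
      FrobEqFrobInfty W K (2 ^ 1) ℓ →
      ∀ d : galH1Torsion (W.baseChange K) ((2 ^ 1 : ℕ) : ℤ), conjAct W c ((2 ^ 1 : ℕ) : ℤ) d = d →
      (∀ v : HeightOneSpectrum (𝓞 K), (ℓ : 𝓞 K) ∉ v.asIdeal →
        d ∈ selmerLocalKer (W.baseChange K) (v.adicCompletion K) ((2 ^ 1 : ℕ) : ℤ)) →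
      (∀ w : InfinitePlace K, d ∈ selmerLocalKer (W.baseChange K) w.Completion ((2 ^ 1 : ℕ) : ℤ)) →
      d ∉ selmerLocalKer (W.baseChange K) (hℓ.place.adicCompletion K) ((2 ^ 1 : ℕ) : ℤ) →
      ∀ ξ : galH1Torsion W ((2 ^ 1 : ℕ) : ℤ),
      ((∀ v : HeightOneSpectrum (𝓞 ℚ), v ≠ u →
          ξ ∈ selmerLocalKer W (v.adicCompletion ℚ) ((2 ^ 1 : ℕ) : ℤ)) ∧
          ∀ w : InfinitePlace ℚ, ξ ∈ selmerLocalKer W w.Completion ((2 ^ 1 : ℕ) : ℤ)) →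
      ξ ∈ W.torsionLocalKer (u.adicCompletion ℚ) ((2 ^ 1 : ℕ) : ℤ) →
      resTorsion W K ((2 ^ 1 : ℕ) : ℤ) ξ ∈
        (W.baseChange K).torsionLocalKer (hℓ.place.adicCompletion K) ((2 ^ 1 : ℕ) : ℤ))
    (hlag : ∀ ξ₁ ξ₂ : galH1Torsion W ((2 ^ 1 : ℕ) : ℤ),
      ((∀ v : HeightOneSpectrum (𝓞 ℚ), v ≠ u →
          ξ₁ ∈ selmerLocalKer W (v.adicCompletion ℚ) ((2 ^ 1 : ℕ) : ℤ)) ∧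
          ∀ w : InfinitePlace ℚ, ξ₁ ∈ selmerLocalKer W w.Completion ((2 ^ 1 : ℕ) : ℤ)) →
      ((∀ v : HeightOneSpectrum (𝓞 ℚ), v ≠ u →
          ξ₂ ∈ selmerLocalKer W (v.adicCompletion ℚ) ((2 ^ 1 : ℕ) : ℤ)) ∧
          ∀ w : InfinitePlace ℚ, ξ₂ ∈ selmerLocalKer W w.Completion ((2 ^ 1 : ℕ) : ℤ)) →
      ξ₁ ∉ W.torsionLocalKer (u.adicCompletion ℚ) ((2 ^ 1 : ℕ) : ℤ) →
      ξ₂ ∉ W.torsionLocalKer (u.adicCompletion ℚ) ((2 ^ 1 : ℕ) : ℤ) →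
      ξ₁ - ξ₂ ∈ W.torsionLocalKer (u.adicCompletion ℚ) ((2 ^ 1 : ℕ) : ℤ)) :
    ∀ s ∈ selmerGroup (W.baseChange K) ((2 ^ 1 : ℕ) : ℤ),
      s = 0 ∨ s = kummerMapTorsion (W.baseChange K) ((2 ^ 1 : ℕ) : ℤ) hdiv P := by
  have hΔ : W.Δ < 0 := KolyvaginEigenTwo.Δ_neg_of_cmInert_two W hCM hin hsurj
  have hΔK : ¬ IsSquare (W.baseChange K).Δ := by
    have h : (W.baseChange K).Δ = algebraMap ℚ K W.Δ := by rw [baseChange, map_Δ]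
    rw [h]
    exact KolyvaginImageTwo.not_isSquare_algebraMap_Δ_of_cmInert_two_of_heegner W hCM hin hsurj K hK
      hH
  -- `τ = 1` on `Sel₂(E/K)` (g6) and the point system at `(2, 1)` from ty2's data
  have hτ := KolyvaginDescentTwo.conjAct_eq_self_of_cmInert_families_two W hCM hin hsurj hK hH hP hc
    hy D R
  obtain ⟨ε, τ, hτl, A, hA, Pt, hPt, hε, h53, hAτ, hPt1, hm'⟩ :=
    Rank1Residual.P2.KolyvaginMachine.hpoints_of_pointSystemFamily D le_rfl hdiv c hc
  exact selmer_two_eq_zero_or_eq_kummer_of_hpoints W hK P hsurj hΔ hΔK hc hy (q := 2 ^ 1) (pow_one 2)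
    hdiv ⟨ε, τ, hτl, A, hA, Pt, hPt, hε, h53, hAτ, hPt1, fun m hm hq ↦ hm' m hm fun q' hq' ↦
      ⟨(hq q' hq').1, (hq q' hq').2, KolyvaginDescentTwo.cmInert_of_isKolyvaginPrime_two W hCM hin hsurj
        (hq q' hq').1⟩⟩ hτ hinj u hdesc hdual hlag

end Summit.BirchSwinnertonDyer.BirchSwinnertonDyer.Theorems.KolyvaginRatDescentTwo

end
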